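import Summits.BirchSwinnertonDyer.BirchSwinnertonDyer.Theorems.EdixhovenFibreFiveSevenStarredOptimalManinUnitFiveSevenTransportedHodgePairHneOmega
import Literature.NumberTheory.PAdicHodge.BmaxPlusTransportedReciprocityTransportHom
import Literature.NumberTheory.PAdicHodge.PadicLogCurveFOChart
import Literature.NumberTheory.EllipticCurves.PadicLogFiniteExtensionLocalFieldProofs
import HarnessLib

/-!
# Kato's explicit reciprocity law for a curve `W/K₀` mapping onto a RAMIFIED good supersingular model by an equivariant HOMOMORPHISM of geometric
# points with `T_p(φ)` an isomorphism (`→+` twin of `…TransportedReciprocityTransport`: the isogeny road) — points over deep formal points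

Cell `pub/bsd-wall`, D-0145 line `route-BirchSwinnertonDyer-EdixhovenFibreFiveSeven`, seat `bsd-line-edix-p4` (gen 28); crux K★
`stmt-BirchSwinnertonDyer-22226` (`StarredOptimalManinUnitFiveSeven`), line `kato_lever`, memo `Cruxes/StarredOptimalManinUnitFiveSeven/Lines/
kato-lever-seam-rec-at-cells.md` §5 (row `c′, hrec′`). THEOREMS ONLY (no definition, no named fact, no instance, no `sorry`); helper
`--supports stmt-BirchSwinnertonDyer-22226`. **BSD is not proved by this file, and neither is K★ or [REC-tower]**: it is the `φ`-twin of
`…TransportedReciprocity` / `…TransportedReciprocityAllPoints` — the SAME chain (transported period maps `exists_transported_periodHoms`, Hodge line and `hne`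
from `TransportedHodgePairHneOmega.exists_hodgePair_fil_and_hne`, T5-B along the TRANSPORT matching `BmaxPlusTransportedReciprocityTransport`, the chart
`PadicLogCurveFOChart`, the index step) for a Weierstrass curve `W` over a subfield `K₀ ⊆ F = K_v` that is ISOMORPHIC over `F` to the good `𝒪_D`-model
`E = curveFO F (W_D ⊗_ψ 𝒪_F)` (`φ` equivariant on geometric points with Tate-module map `T_p(φ)`, and for the all-points form its `F`-rational restriction `φ_F`),
so that the pairing `⟨[η], P⟩`, `exp*_d`, the line `d` and the representation are those of `W` ITSELF — for the K★ cells `K₀ = ℚ`, `W = W_min`,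
`F = ℚ_p(ζ_m)_w(ϖ)`: the hypothesis `hrec'` of `…ReciprocityTowerFromAbove.exists_const_tower_clauses_of_formula_above` up to the unit rescaling of `log_ω`
under the change of variables (`log_ω^E(φ_F P)` vs `log_ω^{W ⊗ F}(P)`), not done here.

* ★★★★ `exists_const_tatePairingPoint_eq_neg_trace_of_omegaPeriod_ne_zero_transport` — at the points of `W(F)` over deep formal points of the model, free `c_P`;
* (next file `…TransportedReciprocityTransportAllPoints`) `exists_const_tatePairingPoint_eq_trace_mul_padicLog_transport` — EVERY `P ∈ W(F)`.

What a K★ cell must still supply: its instances (`W_D`, `E₀`, `p ∈ {5,7}`, `map_explicitModel_eq_map_cmFibre`), the change of variables `φ` (with `T_p(φ)`,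
`φ_F`) from `W_min ⊗ F` onto the model and the rescaling of `log_ω` under it (`PadicLogFiniteExtensionVariableChangeProofs`), (N1′) (tree), the Weil tower /
`ψ` / de Rham binders, and the descent / Galois averaging (`…ReciprocityTowerFromAbove`); K★ needs in addition P1-bar (print) and REC at the ordinary cells.

References: [cite: Kato1993LNM1553, Ch. II Thm. 1.4.1 (3)–(4), Lemma 1.4.3] · [cite: BlochKato1990, Ex. 3.10.1, Example 3.11] ·
[cite: Colmez1992PeriodesAbeliennes, §2] · [cite: Katz1981CrystallineDieudonne, Thm. 5.1.4–5.1.5] · [cite: SilvermanAEC2009, Thm. IV.6.4, Prop. VII.2.2, VIII §2, X §4].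
-/

set_option autoImplicit false
-- single-conjunct summit: `Summit.BirchSwinnertonDyer.BirchSwinnertonDyer.…` repeats the name by design
set_option linter.dupNamespace false

noncomputable section

open Field Function ValuativeRel WittVector NumberField IsDedekindDomain
open scoped NumberField Topology Classical NNReal
open Literature.NumberTheory.PAdicHodge Literature.NumberTheory.GaloisRepresentations
  Literature.NumberTheory.GaloisRepresentations.IsNonarchimedeanLocalField Literature.NumberTheory.GaloisRepresentations.LubinTate
  Literature.NumberTheory.GaloisCohomology Literature.NumberTheory.EllipticCurves Literature.NumberTheory.EllipticCurves.FormalGroupChart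
  Literature.NumberTheory.PAdicHodge.GaloisContinuity Literature.IUT.LogVolume Literature.RingTheory.FormalGroups
  Literature.AlgebraicGeometry.Resolution _root_.WeierstrassCurve

namespace Summit.BirchSwinnertonDyer.BirchSwinnertonDyer.Theorems.TransportedReciprocityTransportHom

variable {K : Type} [Field K] [NumberField K] {p : ℕ} [hprime : Fact p.Prime] (v : HeightOneSpectrum (𝓞 K))
  [CharZero (v.adicCompletion K)] [LocallyCompactSpace (absoluteGaloisGroup (v.adicCompletion K))]
  [Fact (¬ IsUnit (p : integerC (v.adicCompletion K)))]
  [IsAdicComplete (Ideal.span {(p : integerC (v.adicCompletion K))}) (integerC (v.adicCompletion K))]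
  [CharP 𝓀[v.adicCompletion K] p] [CharZero (CompletedAlgClosure (v.adicCompletion K))]
  (hpv : valuation (v.adicCompletion K) (p : v.adicCompletion K) < 1)
  (Dv : EisensteinRoot (v.adicCompletion K) p hpv) (Wm : WeierstrassCurve (EisensteinRoot.CoeffDisc Dv))
  (ψm : EisensteinRoot.CoeffDisc Dv →+* LTCoeff (v.adicCompletion K))
  (hψm : ∀ c, algebraMap (LTCoeff (v.adicCompletion K)) (v.adicCompletion K) (ψm c) = EisensteinRoot.CoeffDisc.toF Dv c)
  (hp2 : p ≠ 2) (hΔ : IsUnit (Wm.map ψm).Δ) (hA : ((Wm.map ψm).map (AinfTop.redCoeff (v.adicCompletion K))).hasseCoeff p = 0)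
  [(AinfTop.curveFO (v.adicCompletion K) (Wm.map ψm)).IsElliptic]
  [(curveOver (CompletedAlgClosure (v.adicCompletion K)) (Wm.map ψm)).IsElliptic]
  -- the curve `W/K₀`, the isomorphism of geometric points onto the good model, and its Tate-module map
  {K₀ : Type} [Field K₀] [CharZero K₀] (W : WeierstrassCurve K₀) [W.IsElliptic] [Algebra K₀ (v.adicCompletion K)]
  (φ : geomPoints (W.baseChange (v.adicCompletion K)) →+ (AinfTop.curveFO (v.adicCompletion K) (Wm.map ψm)).geomPoints)
  (hφ : ∀ (σ : absoluteGaloisGroup (v.adicCompletion K)) (P : geomPoints (W.baseChange (v.adicCompletion K))), φ (σ • P) = σ • φ P)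
  (Tφ : (W.baseChange (v.adicCompletion K)).tateModule p ≃ₗ[ℤ_[p]] (AinfTop.curveFO (v.adicCompletion K) (Wm.map ψm)).tateModule p)
  (hTφ : ∀ (a : (W.baseChange (v.adicCompletion K)).tateModule p) (n : ℕ), TateModule.proj p n (Tφ a) = φ (TateModule.proj p n a))
  -- the Weil tower of `W`
  (e : (k : ℕ) → geomTorsion W ((p ^ k : ℕ) : ℤ) → geomTorsion W ((p ^ k : ℕ) : ℤ) → AlgebraicClosure K₀)
  (hμ : ∀ k S T, e k S T ^ (p ^ k) = 1) (hadd₁ : ∀ k S₁ S₂ T, e k (S₁ + S₂) T = e k S₁ T * e k S₂ T)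
  (hadd₂ : ∀ k S T₁ T₂, e k S (T₁ + T₂) = e k S T₁ * e k S T₂)
  (hgal : ∀ k (σ : absoluteGaloisGroup K₀) (S T : geomTorsion W ((p ^ k : ℕ) : ℤ)), σ • e k S T = e k (σ • S) (σ • T))
  (hcompat : ∀ k (S T : geomTorsion W ((p ^ (k + 1) : ℕ) : ℤ)),
    e k (torsionMulHom W (p ^ (k + 1)) (p ^ k) p (pow_succ p k).symm S)
      (torsionMulHom W (p ^ (k + 1)) (p ^ k) p (pow_succ p k).symm T) = e (k + 1) S T ^ p)

set_option maxHeartbeats 3200000 in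
include hgal hp2 hΔ hA hψm hφ hTφ in
/-- ★★★★ **Kato's explicit reciprocity law for `W/K₀` (isomorphic over `F = K_v` to a ramified good supersingular model) at the points of `W(F)` mapping
to deep formal points of the model, from the cells' data and (N1′) alone.** `E = curveFO F (W_D ⊗_ψ 𝒪_F)` good supersingular, `W_D ≡ E₀ (mod ϖ)`, `E₀/ℤ` good
supersingular at `p ≥ 5`; `φ : (W ⊗ F)(F̄) ≃ E(F̄)` equivariant with Tate-module map `T_p(φ)`; an index `N ≥ e`; (N1′) `∫_τ ω_{W_D} ≠ 0` for some `τ`; the cell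
data of the socket FOR `W` (Weil tower of `W`, de Rham binders of `T_pW|_{Γ_F}`). Then there is ONE `c ∈ F` such that for every `η ∈ Z¹(Γ_F, T_pW)`, every
`P ∈ W(F)` with a `p`-power division sequence `Q` in `W(F̄)` (`Q₀ = P`) whose image `φ Q₀` is a formal point of `E` with `‖z(φ Q₀)‖^N ≤ ‖p‖`, and every
`c_P ∈ F` with `ι(c_P) = p^N·Σ'[Xʲ]log_{W_D}·z(φ Q₀)ʲ`: **`⟨[η], P⟩_W = −Tr_{F/ℚ_p}(c_P · exp*_d(η) · c)`** — pairing, `exp*`, `d`, representation those of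
`W` ITSELF; NO Hodge-line, `hne`, (K₂), cocycle, integrating-pair or period-map hypothesis (the `φ`-twin of
`TransportedReciprocity.exists_const_tatePairingPoint_eq_neg_trace_of_omegaPeriod_ne_zero`). [cite: Kato1993LNM1553, Ch. II Thm. 1.4.1 (3)–(4), Lemma 1.4.3] [cite: BlochKato1990, Ex. 3.10.1, Example 3.11]
[cite: Colmez1992PeriodesAbeliennes, §2] [cite: Katz1981CrystallineDieudonne, Thm. 5.1.4–5.1.5] -/
theorem exists_const_tatePairingPoint_eq_neg_trace_of_omegaPeriod_ne_zero_transportHom (hp5 : 5 ≤ p)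
    (E₀ : WeierstrassCurve ℤ)
    (hWE : Wm.map (Ideal.Quotient.mk (Ideal.span {EisensteinRoot.CoeffDisc.of Dv (AdjoinRoot.root Dv.poly)})) =
      (E₀.map (algebraMap ℤ (EisensteinRoot.CoeffDisc Dv))).map
        (Ideal.Quotient.mk (Ideal.span {EisensteinRoot.CoeffDisc.of Dv (AdjoinRoot.root Dv.poly)})))
    (hΔ₀ : ¬ (p : ℤ) ∣ E₀.Δ) (hA₀ : (E₀.map (Int.castRingHom (ZMod p))).hasseCoeff p = 0)
    [(E₀.map (Int.castRingHom ℚ_[p])).IsElliptic] [(E₀.map (Int.castRingHom (ZMod p))).IsElliptic]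
    [(curveOver (CompletedAlgClosure (v.adicCompletion K)) E₀).IsElliptic]
    {N : ℕ} (hN : Dv.e ≤ N)
    (hN1' : ∃ τ : AinfTop.TatePtO (v.adicCompletion K) (Wm.map ψm) p,
      AinfRamTop.omegaPeriod Wm (surjective_fontaineTheta_integerC hpv) (AinfTop.seqO (Wm.map ψm) τ) (AinfTop.seqO_zero (Wm.map ψm) τ)
        (AinfRamTop.mulPC_seqO Wm ψm hψm τ) ≠ 0)
    (ψ : C(absoluteGaloisGroup (v.adicCompletion K), ℤ_[p])) (hψ : ∀ σ τ, ψ (σ * τ) = ψ σ + ψ τ)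
    (hψlog : ∀ τ, (ψ τ : ℚ_[p]) = logCyclotomic (F := (v.adicCompletion K)) p τ)
    (heL : ∀ (c : ℤ_[p]) (S U : W.tateModule p),
      (weilContPairingPadic W (v.adicCompletion K) p e hμ hadd₁ hadd₂ hgal hcompat).toLin (c • S) U =
      twistHom (v.adicCompletion K) p ((weilContPairingPadic W (v.adicCompletion K) p e hμ hadd₁ hadd₂ hgal hcompat).toLin S U) c)
    (healt : ∀ S : W.tateModule p,
      (weilContPairingPadic W (v.adicCompletion K) p e hμ hadd₁ hadd₂ hgal hcompat).toLin S S = 0)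
    (henondeg : ∀ S : W.tateModule p,
      (∀ U, (weilContPairingPadic W (v.adicCompletion K) p e hμ hadd₁ hadd₂ hgal hcompat).toLin S U = 0) → S = 0)
    (hinj : letI := LocalField.padicAlgebra (v.adicCompletion K) p hpv
      (bdRPeriodRingData (F := (v.adicCompletion K)) (p := p) hpv).CupLogInjective (logCyclotomic p)
        (restrictedRationalTateRep W (v.adicCompletion K) p))
    (hde : letI := LocalField.padicAlgebra (v.adicCompletion K) p hpv
      ∀ η : contOneCocycles (restrictedTateRep W (v.adicCompletion K) p).toTopRep,
        (bdRPeriodRingData (F := (v.adicCompletion K)) (p := p) hpv).HasDualExp (logCyclotomic p)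
          (restrictedRationalTateRep W (v.adicCompletion K) p)
          fun σ => TateModule.toRational p (η.1 σ))
    (d : letI := LocalField.padicAlgebra (v.adicCompletion K) p hpv
      (bdRPeriodRingData (F := (v.adicCompletion K)) (p := p) hpv).FilZeroLine
        (restrictedRationalTateRep W (v.adicCompletion K) p)) :
    letI := LocalField.padicAlgebra (v.adicCompletion K) p hpv
    ∃ c : v.adicCompletion K,
      ∀ (η : contOneCocycles (restrictedTateRep W (v.adicCompletion K) p).toTopRep)
        (P : (W.baseChange (v.adicCompletion K)).toAffine.Point)
        (Q : ℕ → geomPoints (W.baseChange (v.adicCompletion K)))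
        (hQ : ∀ n, p • Q (n + 1) = Q n)
        (_hQ0 : Q 0 = toGeomPoints (W.baseChange (v.adicCompletion K)) P)
        (hP1 : AinfTop.geomToCO (Wm.map ψm) (φ (Q 0)) ∈ kernel (NormedField.valuation (K := CompletedAlgClosure (v.adicCompletion K)))
          (curveOver (CompletedAlgClosure (v.adicCompletion K)) (Wm.map ψm))),
        ‖((zPt (AinfTop.geomToCO (Wm.map ψm) (φ (Q 0))) hP1 : CBall (v.adicCompletion K)) : CompletedAlgClosure (v.adicCompletion K))‖ ^ N ≤
            ‖(p : CompletedAlgClosure (v.adicCompletion K))‖ →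
        ∀ cP : v.adicCompletion K,
          algebraMap (v.adicCompletion K) (CompletedAlgClosure (v.adicCompletion K)) cP =
            (p : CompletedAlgClosure (v.adicCompletion K)) ^ N *
              ∑' j : ℕ, PowerSeries.coeff j (Wm.map ((CBall (v.adicCompletion K)).subtype.comp (EisensteinRoot.CoeffDisc.toCBall Dv))).formalLog *
                ((zPt (AinfTop.geomToCO (Wm.map ψm) (φ (Q 0))) hP1 : CBall (v.adicCompletion K)) : CompletedAlgClosure (v.adicCompletion K)) ^ j →
          ((tatePairingPoint W (v.adicCompletion K) p e hμ hadd₁ hadd₂ hgal hcompat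
              (oneCocycleClass _ η) P : ℤ_[p]) : ℚ_[p]) =
            -Algebra.trace ℚ_[p] (v.adicCompletion K) (cP * (expStarCoord W hpv d η * c)) := by
  -- the transported period maps at index `N` (edix-p4 g26)
  obtain ⟨LT, P₀, Q₀, hLT, hP₀, hQ₀, hP₀Z, hQ₀Z, hP₀g, hQ₀g⟩ :=
    exists_transported_periodHoms Dv Wm E₀ hWE ψm hψm (hθ := surjective_fontaineTheta_integerC hpv) hN
  haveI := isDomain_bDeRhamPlus (F := v.adicCompletion K) (p := p) (surjective_fontaineTheta_integerC hpv)
  haveI : IsDomain (BdRPlusTop (v.adicCompletion K) p) := isDomain_bDeRhamPlus (F := v.adicCompletion K) (p := p)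
    (surjective_fontaineTheta_integerC hpv)
  -- LEAD g28's one-call package: Hodge-line scalars with their analytic bound, `Fil¹`, and `hne` from (N1′)
  obtain ⟨a, b, dHL, c, hHLsum, -, hneΩ⟩ := TransportedHodgePairHneOmega.exists_hodgePair_fil_and_hne Dv
    (hθ := surjective_fontaineTheta_integerC hpv) Wm E₀ hWE ψm hψm hp2 hN hLT hP₀ hQ₀
  -- the scalars `A = Σ aᵢϖⁱ`, `B = Σ bᵢϖⁱ` of `F`
  obtain ⟨A, hA'⟩ : ∃ A' : v.adicCompletion K,
      A' = ∑ i : Fin Dv.e, algebraMap (PadicBase (v.adicCompletion K) p hpv) (v.adicCompletion K) (a i) * Dv.root ^ (i : ℕ) := ⟨_, rfl⟩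
  obtain ⟨B, hB'⟩ : ∃ B' : v.adicCompletion K,
      B' = ∑ i : Fin Dv.e, algebraMap (PadicBase (v.adicCompletion K) p hpv) (v.adicCompletion K) (b i) * Dv.root ^ (i : ℕ) := ⟨_, rfl⟩
  have hAC : algebraMap (v.adicCompletion K) (CompletedAlgClosure (v.adicCompletion K)) A =
      ∑ i : Fin Dv.e, algebraMap (v.adicCompletion K) (CompletedAlgClosure (v.adicCompletion K))
        (algebraMap (PadicBase (v.adicCompletion K) p hpv) (v.adicCompletion K) (a i)) *
          ((Dv.rootC : integerC (v.adicCompletion K)) : CompletedAlgClosure (v.adicCompletion K)) ^ (i : ℕ) := by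
    rw [hA', map_sum]
    refine Finset.sum_congr rfl fun i _ => ?_
    rw [map_mul, map_pow, EisensteinRoot.coe_rootC]
  have hBC : algebraMap (v.adicCompletion K) (CompletedAlgClosure (v.adicCompletion K)) B =
      ∑ i : Fin Dv.e, algebraMap (v.adicCompletion K) (CompletedAlgClosure (v.adicCompletion K))
        (algebraMap (PadicBase (v.adicCompletion K) p hpv) (v.adicCompletion K) (b i)) *
          ((Dv.rootC : integerC (v.adicCompletion K)) : CompletedAlgClosure (v.adicCompletion K)) ^ (i : ℕ) := by
    rw [hB', map_sum]
    refine Finset.sum_congr rfl fun i _ => ?_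
    rw [map_mul, map_pow, EisensteinRoot.coe_rootC]
  -- the Hodge line in the shape of T2c
  have hHL : ∀ n : ℕ, ‖(p : CompletedAlgClosure (v.adicCompletion K)) ^ dHL * PowerSeries.coeff n
      ((Wm.map ((CBall (v.adicCompletion K)).subtype.comp (EisensteinRoot.CoeffDisc.toCBall Dv))).formalLog -
        PowerSeries.C (algebraMap (v.adicCompletion K) (CompletedAlgClosure (v.adicCompletion K)) A) *
          (E₀.map (Int.castRingHom (CompletedAlgClosure (v.adicCompletion K)))).formalLog -
        PowerSeries.C (algebraMap (v.adicCompletion K) (CompletedAlgClosure (v.adicCompletion K)) B) *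
          PowerSeries.expand p hprime.out.ne_zero (E₀.map (Int.castRingHom (CompletedAlgClosure (v.adicCompletion K)))).formalLog)‖ ≤ 1 := by
    rw [hAC, hBC]; exact hHLsum
  -- `hne` (both branches) at the (N1′)-witness, after cancelling the unit `ι(p^c)`; `(A, B) ≠ 0` from it
  obtain ⟨τ₁, hτ₁⟩ := hN1'
  have hne₁ : BdRPlusTop.of (v.adicCompletion K) p (embBdRHom hpv (surjective_fontaineTheta_integerC hpv) A) * P₀ τ₁ +
      BdRPlusTop.of (v.adicCompletion K) p (embBdRHom hpv (surjective_fontaineTheta_integerC hpv) B) * Q₀ τ₁ ≠ 0 := by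
    have h := hneΩ τ₁ hτ₁
    rw [← hA', ← hB', map_mul, map_mul, map_mul, map_mul, mul_assoc, mul_assoc, ← mul_add] at h
    exact right_ne_zero_of_mul h
  have hAB : A ≠ 0 ∨ B ≠ 0 :=
    TransportedHodgePairHneOmega.ne_zero_or_ne_zero_of_pair_ne_zero (surjective_fontaineTheta_integerC hpv) hne₁
  -- T5-B (this seat), applied STEPWISE (a one-shot application of this many-binder theorem is prohibitively slow to elaborate)
  have h1 := exists_const_tatePairingPoint_eq_neg_trace_transported_formalPoint_transportHom v hpv Dv Wm ψm hψm hp2 hΔ hA W φ hφ Tφ hTφ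
    e hμ hadd₁ hadd₂ hgal hcompat hp5 E₀ hWE hΔ₀ hA₀ (N := N) hN (LT := LT) (P₀ := P₀) (Q₀ := Q₀)
  have h2 := h1 hLT
  have h3 := h2 hP₀ hQ₀ hP₀Z hQ₀Z hP₀g hQ₀g A B dHL
  have h4 := h3 hHL hAB (fun _ => ⟨τ₁, hne₁⟩) ψ hψ hψlog
  have h5 := h4 heL healt henondeg
  exact h5 hinj hde d

end Summit.BirchSwinnertonDyer.BirchSwinnertonDyer.Theorems.TransportedReciprocityTransportHom

end
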